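import Summits.BirchSwinnertonDyer.Rank1Residual.O6.X3WildOfKMCOfReadings
import Summits.BirchSwinnertonDyer.Rank1Residual.Additive.GordIsogenyInvariance
import Summits.BirchSwinnertonDyer.Rank1Residual.AdditivePotMult.Twist
import Summits.BirchSwinnertonDyer.Rank1Residual.X2.IsogenyClassStability
import Summits.BirchSwinnertonDyer.Rank1Residual.EisensteinPrimes
import Literature.NumberTheory.EllipticCurves.IsogenyTorsionFreeMemberProofs
import HarnessLib

/-!
# The Kato descent WITHOUT (12.5.2): the torsion-free member EXISTS — `O6Sharp` / `O5Sharp` /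
# `PotGoodLowerHalfRankZero` from KMC⁺ (⊕ PR^×) at torsion-free members, with NO member binder
# (cell `bsd-potss`, seat `kmc`, generation 4; part 10 of the descent files; kernel assemblies over
# the image-free readings of part 8a, nothing asserted)

HONEST FRAMING (cell `bsd-potss`, `run/shared/lean/pub/bsd-potss/`, FULL-BSD rank-`≤ 1` programme
tranche 1b, rows B4/B5/B8; typed against the class shells of cell `b2b-bsdres`): NOTHING about Kato's
Main Conjecture or Perrin-Riou's conjecture is asserted and no Literature fact is minted; every
input is a displayed hypothesis — the image-free readings `TorsionFree.DescentCountReading`,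
`TorsionFree.RankOneCountReading`, `TorsionFree.RealizableOfKMC` (part 8a), the interface lemma
`ReadsTrivialKMC` (part 1), the interface `KMC`, the node `PerrinRiouUpToUnitAt` (part 5), the
published facts Cassels (`bsdRHS_eq_of_isIsogenous`), GZK (`rank_eq_analyticRank_of_analyticRank_le_one`),
modularity (`hasEntireLFunction_rat`) and — new in this part — Mazur–Kenku
(`mazurKenku_exists_cyclic_isogeny`, Silverman *AEC* IX.6 Ex. 6.4). Census numbers are not inputs;
nothing is booked; no mark of `RESIDUAL-MAP.md` moves; O5/O6 stay OPEN.

## What part 10 adds to parts 8–9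

Parts 8b/9 (`KatoDescentTorsionFree`, `O6/X3WildOfKMCOfReadings`) run the descent at a member `W′`
of the isogeny class with `p ∤ #W′(ℚ)_tors` and DISPLAY that member as a binder
(`O6.IsogTorsionFreeAt3`, the `hK3`/`hmem` hypotheses of `o6Sharp_of_kmc_torsionFree_members` /
`o5Sharp_of_kmc_torsionFree_members`: "exists for every class by Mazur–Kenku — displayed, not
proved"). This file PROVES the member exists and discharges the binder:

* §1 `Addv.of_isIsogenous_of_padicValRat_j_nonneg` — **"additive AND potentially good at `p`" is a
  `ℚ`-isogeny invariant** (any prime `p`, any models): bad at `p` by *AEC* VII.7.2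
  (`hasGoodReductionAtPrime_iff_of_isIsogenous`), not multiplicative by the same
  (`X2.mult_iff_of_isIsogenous`), and `ord_p j ≥ 0` transfers because a potentially multiplicative
  member would have a `p`-multiplicative quadratic twist (`AdditivePotMult.PotMult.exists_twist_mult`,
  *ATAEC* V.5.3) whose isogenous partner `E^{(d)}` (`IsIsogenous.quadraticTwist`) would be
  multiplicative too, forcing `ord_p j(E) < 0` (`EisensteinPrimes.padicValRat_j_neg_of_mult`).
* §2 `Addv.exists_torsionFree_member` — **every additive potentially good pair `(E, p)`, `p` odd,
  has a globally minimal `ℚ`-isogenous `E′`, additive potentially good at `p`, with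
  `p ∤ #E′(ℚ)_tors`** (the tree's `exists_isIsogenous_isGloballyMinimal_not_dvd_torsionOrder`: the
  isogeny walk `E → E/⟨P⟩ → …` stays cyclic by Mazur's (5.4) and stops by Mazur–Kenku; + §1);
  `ClassO6.exists_isogTorsionFreeAt3` fills the `isog` slot of `O6.X3WildOfKMC`.
* §3 THE K9 GLUE WITHOUT A MEMBER BINDER: `potGoodLowerHalfRankZero_of_kmc_torsionFree` (the cell's
  UNIFORM rank-0 node `PotGoodLowerHalfRankZero` — B4 ∪ B5, every odd additive potentially good `p`,
  any image — from KMC at the torsion-free additive potentially good curves ALONE, r0 readings),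
  `O6.wildLowerHalfRankZero_of_kmc_torsionFree` (its O6 restriction = the K9 crux
  `WildLowerHalfRankZero` of route `KatoDescentPotSupersingular`, verbatim shape),
  `O6.wildRankOne_of_kmc_perrinRiou_torsionFree` (the route's residual `WildRankOne`, verbatim shape),
  `o6Sharp_of_kmc_torsionFree` / `o5Sharp_of_kmc_torsionFree` (the rung leaves K9 / K8-twin from
  KMC⁺ ⊕ PR^× at torsion-free members), `O6.X3Wild.missingPPartAt_three_of_kmc_isogTorsionFree` (the
  shell's `isog` existential instantiated by §2).

NOT proved (recorded): KMC itself (D-O6-2), PR^× (BKS19 Conj. 1.5), the readings; `p = 2` (the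
member statement is false there: class 15a).

References: Kato, Astérisque 295 (2004) Conj. 12.10; Burns–Kurihara–Sano arXiv:1910.07404 Thm. 7.6;
Mazur, Invent. Math. 44 (1978) Thm. 1; Kenku, J. Number Theory 15 (1982) Thm. 1; Mazur, Publ. Math.
IHÉS 47 (1977) (5.4); Silverman *AEC* VII.5.5, VII.7.2, IX.6 Ex. 6.4; *ATAEC* V.5.3; Cassels 1965.
-/

noncomputable section

open scoped Classical

open WeierstrassCurve Literature.NumberTheory.EllipticCurves
  Literature.NumberTheory.EllipticCurves.Rank1Residual
  Literature.NumberTheory.EllipticCurves.Rank1Residual.Typed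

namespace Summit.BirchSwinnertonDyer.Rank1Residual

/-! ## §1 "Additive and potentially good at `p`" is a `ℚ`-isogeny invariant -/

namespace Additive

/-- **Additivity with `ord_p j ≥ 0` transfers along every `ℚ`-isogeny** (any prime `p`, any
Weierstrass models). Bad at `p`: good reduction is an isogeny invariant (*AEC* VII.7.2,
`hasGoodReductionAtPrime_iff_of_isIsogenous`); not multiplicative: so is multiplicative reduction
(`X2.mult_iff_of_isIsogenous`); `ord_p j(E') ≥ 0`: otherwise `E'` is potentially multiplicative, some
twist `E'^{(d)}` is multiplicative at `p` (`AdditivePotMult.PotMult.exists_twist_mult`), hence so is the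
isogenous `E^{(d)}` (`IsIsogenous.quadraticTwist`), and then `ord_p j(E) = ord_p j(E^{(d)}) < 0`
(`EisensteinPrimes.padicValRat_j_neg_of_mult`), contradiction.
[cite: SilvermanAEC2009, Cor. VII.7.2 and Prop. VII.5.5] -/
theorem Addv.of_isIsogenous_of_padicValRat_j_nonneg {W W' : WeierstrassCurve ℚ} [W.IsElliptic]
    [W'.IsElliptic] {p : ℕ} [Fact p.Prime] (hadd : Addv W p) (hj : 0 ≤ padicValRat p W.j)
    (h : IsIsogenous W W') : Addv W' p ∧ 0 ≤ padicValRat p W'.j := by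
  have hadd' : Addv W' p :=
    ⟨fun hg ↦ hadd.1 ((hasGoodReductionAtPrime_iff_of_isIsogenous h p).mpr hg),
      fun hm ↦ hadd.2 ((X2.mult_iff_of_isIsogenous (p := p) h).mpr hm)⟩
  refine ⟨hadd', ?_⟩
  by_contra hj'
  push Not at hj'
  obtain ⟨d, hd0, hmultd⟩ := AdditivePotMult.PotMult.exists_twist_mult (W := W') (p := p) ⟨hadd', hj'⟩
  haveI : NeZero (2 : ℚ) := ⟨two_ne_zero⟩
  haveI : (W.quadraticTwist d).IsElliptic := W.isElliptic_quadraticTwist hd0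
  haveI : (W'.quadraticTwist d).IsElliptic := W'.isElliptic_quadraticTwist hd0
  have hmult : Mult (W.quadraticTwist d) p :=
    (X2.mult_iff_of_isIsogenous (p := p) (h.quadraticTwist hd0)).mpr hmultd
  have hneg := EisensteinPrimes.padicValRat_j_neg_of_mult (W.quadraticTwist d) p hmult
  rw [j_quadraticTwist W hd0] at hneg
  exact absurd hj (not_le.mpr hneg)

/-! ## §2 The torsion-free member of an additive potentially good class EXISTS (odd `p`; Mazur–Kenku) -/

/-- **Every additive potentially good pair has a `p`-torsion-free member** (`p` odd, granted
Mazur–Kenku `hMK`): for `E/ℚ` additive at `p` with `ord_p j ≥ 0` there is a globally minimal `E'`,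
`ℚ`-isogenous to `E`, additive at `p` with `ord_p j(E') ≥ 0` and `p ∤ #E'(ℚ)_tors` — the member at
which the image-free Kato descent of parts 8a/8b runs. The tree's
`exists_isIsogenous_isGloballyMinimal_not_dvd_torsionOrder` (isogeny walk + Mazur (5.4) +
Mazur–Kenku) and §1. [cite: SilvermanAEC2009, IX.6 Example 6.4] [cite: Mazur1977, Ch. III §5, (5.4), p. 157] -/
theorem Addv.exists_torsionFree_member (hMK : mazurKenku_exists_cyclic_isogeny)
    {W : WeierstrassCurve ℚ} [W.IsElliptic] {p : ℕ} [Fact p.Prime] (hp2 : p ≠ 2) (hadd : Addv W p)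
    (hj : 0 ≤ padicValRat p W.j) :
    ∃ (W' : WeierstrassCurve ℚ) (_ : W'.IsElliptic) (_ : W'.IsGloballyMinimal),
      IsIsogenous W W' ∧ Addv W' p ∧ 0 ≤ padicValRat p W'.j ∧ ¬ p ∣ W'.torsionOrder := by
  obtain ⟨W', hW', hM', hiso, htors⟩ :=
    exists_isIsogenous_isGloballyMinimal_not_dvd_torsionOrder W p hMK hp2
  haveI := hW'
  obtain ⟨hadd', hj'⟩ := Addv.of_isIsogenous_of_padicValRat_j_nonneg hadd hj hiso
  exact ⟨W', hW', hM', hiso, hadd', hj', htors⟩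

/-- **On O6 the `isog` slot `O6.IsogTorsionFreeAt3` of the shell `O6.X3WildOfKMC` is inhabited**
(granted Mazur–Kenku): every wild pair `(E, 3)` has a globally minimal `ℚ`-isogenous `E'`, additive
potentially good at `3`, with `3 ∤ #E'(ℚ)_tors`. [cite: SilvermanAEC2009, IX.6 Example 6.4] -/
theorem ClassO6.exists_isogTorsionFreeAt3 (hMK : mazurKenku_exists_cyclic_isogeny)
    {W : WeierstrassCurve ℚ} [W.IsElliptic] [W.IsGloballyMinimal] {p : ℕ} [Fact p.Prime]
    (hO : ClassO6 W p) :
    ∃ (W' : WeierstrassCurve ℚ) (_ : W'.IsElliptic) (_ : W'.IsGloballyMinimal),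
      O6.IsogTorsionFreeAt3 W W' := by
  obtain rfl : p = 3 := hO.p_eq_three
  obtain ⟨W', hW', hM', hiso, hadd', hj', htors⟩ :=
    Addv.exists_torsionFree_member hMK hO.1 hO.2.1 hO.padicValRat_j_nonneg
  exact ⟨W', hW', hM', hiso, hadd', fun {_} ↦ hj', htors⟩

end Additive

/-! ## §3 The K9 glue WITHOUT a member binder (kernel assemblies over the readings; nothing asserted) -/

section Consumers

open Additive

variable {IsOf : ∀ (W : WeierstrassCurve ℚ) [W.IsElliptic] [W.IsGloballyMinimal] (p : ℕ) [Fact p.Prime],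
  KatoDescentDatum p → Prop}
variable {PRRatio : ∀ (W : WeierstrassCurve ℚ) [W.IsElliptic] [W.IsGloballyMinimal] (p : ℕ)
  [Fact p.Prime], ℚ_[p] → Prop}
variable {KMC : ∀ (W : WeierstrassCurve ℚ) [W.IsElliptic] [W.IsGloballyMinimal] (p : ℕ), Prop}

/-- **The UNIFORM rank-`0` lower half `PotGoodLowerHalfRankZero` (B4 ∪ B5: every odd additive
potentially good prime, any image, X3 ∪ X4, CM allowed) FOLLOWS from KMC at the torsion-free
additive potentially good curves ALONE** — over the r0 readings 1♭/3♭, the interface lemma,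
Cassels, GZK, modularity, and Mazur–Kenku: at a torsion-free member `W′ ∼ W` (§2) the descent gives
`BSDp W′ p` (`TorsionFree.bsdp_rankZero_of_isIsogenous_of_kmc` transports it to `W` by Cassels), in
particular the lower half at `W`. The member binder of parts 8b/9 is gone.
[cite: Kato2004Asterisque, Conj. 12.10 (p. 224), Prop. 14.16 (p. 244)] [cite: Cassels1965ArithmeticVIII]
[cite: SilvermanAEC2009, IX.6 Example 6.4] -/
theorem Additive.potGoodLowerHalfRankZero_of_kmc_torsionFree (hR : TorsionFree.DescentCountReading IsOf)
    (hreal : TorsionFree.RealizableOfKMC IsOf KMC) (hread : ReadsTrivialKMC IsOf KMC)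
    (hCassels : bsdRHS_eq_of_isIsogenous) (hGZK : rank_eq_analyticRank_of_analyticRank_le_one)
    (hmod : hasEntireLFunction_rat) (hMK : mazurKenku_exists_cyclic_isogeny)
    (hK : ∀ (W : WeierstrassCurve ℚ) [W.IsElliptic] [W.IsGloballyMinimal] (p : ℕ) [Fact p.Prime],
      W.analyticRank = 0 → p ≠ 2 → Addv W p → 0 ≤ padicValRat p W.j → ¬ p ∣ W.torsionOrder →
        KMC W p) :
    PotGoodLowerHalfRankZero := by
  intro W _ _ p _ hr hp2 hadd hj
  obtain ⟨W', hW', hM', hiso, hadd', hj', ht'⟩ := Addv.exists_torsionFree_member hMK hp2 hadd hj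
  haveI := hW'
  haveI := hM'
  have hr' : W'.analyticRank = 0 := by rw [← analyticRank_eq_of_isIsogenous' hiso, hr]
  have hbsd : BSDp W p := TorsionFree.bsdp_rankZero_of_isIsogenous_of_kmc hR hreal hread hCassels hGZK
    hmod W W' p hiso hr hp2 hadd' hj' ht' (hK W' p hr' hp2 hadd' hj' ht')
  haveI : Finite W.sha := (hGZK W (by rw [hr]; exact zero_le_one)).2
  obtain ⟨q, hq, hv⟩ := missingPPartAt_of_bsdp W p hbsd
  exact ⟨q, hq, hv.le⟩

/-- **The K9 crux shape `WildLowerHalfRankZero` — `∀ W, r_an = 0 → ClassO6 W 3 → MissingLowerBoundAt W 3`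
— FOLLOWS from KMC₃ at the `3`-torsion-free wild curves** (the O6 rows of the previous theorem; the
route's two-layer split `KMCThree → DescentGlue → WildLowerHalfRankZero` with the glue PROVED and no
member binder). Nothing is credited: KMC₃ is the hypothesis `hK`, D-O6-2 stands.
[cite: Kato2004Asterisque, Conj. 12.10 (p. 224)] [cite: Cassels1965ArithmeticVIII] -/
theorem O6.wildLowerHalfRankZero_of_kmc_torsionFree (hR : TorsionFree.DescentCountReading IsOf)
    (hreal : TorsionFree.RealizableOfKMC IsOf KMC) (hread : ReadsTrivialKMC IsOf KMC)
    (hCassels : bsdRHS_eq_of_isIsogenous) (hGZK : rank_eq_analyticRank_of_analyticRank_le_one)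
    (hmod : hasEntireLFunction_rat) (hMK : mazurKenku_exists_cyclic_isogeny)
    (hK : ∀ (W : WeierstrassCurve ℚ) [W.IsElliptic] [W.IsGloballyMinimal],
      W.analyticRank = 0 → Addv W 3 → 0 ≤ padicValRat 3 W.j → ¬ 3 ∣ W.torsionOrder → KMC W 3) :
    ∀ (W : WeierstrassCurve ℚ) [W.IsElliptic] [W.IsGloballyMinimal] [Fact (3 : ℕ).Prime],
      W.analyticRank = 0 → ClassO6 W 3 → MissingLowerBoundAt W 3 := by
  intro W _ _ _ hr hO
  obtain ⟨W', hW', hM', hiso, hadd', hj', ht'⟩ :=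
    Addv.exists_torsionFree_member hMK hO.1 hO.2.1 hO.padicValRat_j_nonneg
  haveI := hW'
  haveI := hM'
  have hr' : W'.analyticRank = 0 := by rw [← analyticRank_eq_of_isIsogenous' hiso, hr]
  have hbsd : BSDp W 3 := TorsionFree.bsdp_rankZero_of_isIsogenous_of_kmc hR hreal hread hCassels hGZK
    hmod W W' 3 hiso hr (by decide) hadd' hj' ht' (hK W' hr' hadd' hj' ht')
  haveI : Finite W.sha := (hGZK W (by rw [hr]; exact zero_le_one)).2
  obtain ⟨q, hq, hv⟩ := missingPPartAt_of_bsdp W 3 hbsd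
  exact ⟨q, hq, hv.le⟩

/-- **The K9 residual shape `WildRankOne` — `∀ W, r_an = 1 → ClassO6 W 3 → MissingPPartAt W 3` —
FOLLOWS from KMC₃⁺ ∧ PR^× at the `3`-torsion-free members of each wild class** (readings 1♭/1″♭/3♭,
interface lemma, Cassels, GZK, modularity, Mazur–Kenku; the route's planned re-typing
`KMCThree → PRUnitThree → WildRankOne` with the glue PROVED and no member binder). Nothing credited.
[cite: Kato2004Asterisque, Conj. 12.10 (p. 224)] [cite: BurnsKuriharaSano2019, Conj. 1.5 (p. 5), Thm. 7.6 (p. 29)]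
[cite: Cassels1965ArithmeticVIII] -/
theorem O6.wildRankOne_of_kmc_perrinRiou_torsionFree (hR : TorsionFree.DescentCountReading IsOf)
    (hC : TorsionFree.RankOneCountReading IsOf PRRatio) (hreal : TorsionFree.RealizableOfKMC IsOf KMC)
    (hread : ReadsTrivialKMC IsOf KMC) (hCassels : bsdRHS_eq_of_isIsogenous)
    (hGZK : rank_eq_analyticRank_of_analyticRank_le_one) (hmod : hasEntireLFunction_rat)
    (hMK : mazurKenku_exists_cyclic_isogeny)
    (hK : ∀ (W W' : WeierstrassCurve ℚ) [W.IsElliptic] [W.IsGloballyMinimal] [W'.IsElliptic]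
      [W'.IsGloballyMinimal],
      W.analyticRank = 1 → ClassO6 W 3 → IsIsogenous W W' → Addv W' 3 → 0 ≤ padicValRat 3 W'.j →
        ¬ 3 ∣ W'.torsionOrder → KMC W' 3 ∧ PerrinRiouUpToUnitAt PRRatio W' 3) :
    ∀ (W : WeierstrassCurve ℚ) [W.IsElliptic] [W.IsGloballyMinimal] [Fact (3 : ℕ).Prime],
      W.analyticRank = 1 → ClassO6 W 3 → MissingPPartAt W 3 := by
  intro W _ _ _ hr hO
  obtain ⟨W', hW', hM', hiso, hadd', hj', ht'⟩ :=
    Addv.exists_torsionFree_member hMK hO.1 hO.2.1 hO.padicValRat_j_nonneg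
  haveI := hW'
  haveI := hM'
  obtain ⟨hKMC', hPR'⟩ := hK W W' hr hO hiso hadd' hj' ht'
  exact TorsionFree.missingPPartAt_of_isIsogenous_of_kmc hR hC hreal hread hCassels hGZK hmod W W' 3 hiso
    hr.le hO.1 hadd' hj' ht' (fun _ ↦ hPR') hKMC'

/-- **The K9 rung leaf `O6Sharp` FOLLOWS from the four image-free readings, Cassels, GZK, modularity,
Mazur–Kenku, and KMC₃⁺ ⊕ PR^× at the `3`-torsion-free members of each wild class** — part 9's
`o6Sharp_of_kmc_torsionFree_members` with its member-existence binder DISCHARGED (§2): the hypothesis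
`hK` is asked only at globally minimal curves `W′` that are `ℚ`-isogenous to an O6 pair, additive
potentially good at `3`, with `3 ∤ #W′(ℚ)_tors`. Nothing is credited (KMC, PR^×, readings = hypotheses).
[cite: Kato2004Asterisque, Conj. 12.10 (p. 224)] [cite: BurnsKuriharaSano2019, Thm. 7.6 (p. 29)]
[cite: Cassels1965ArithmeticVIII] [cite: SilvermanAEC2009, IX.6 Example 6.4] -/
theorem o6Sharp_of_kmc_torsionFree (hR : TorsionFree.DescentCountReading IsOf)
    (hC : TorsionFree.RankOneCountReading IsOf PRRatio) (hreal : TorsionFree.RealizableOfKMC IsOf KMC)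
    (hread : ReadsTrivialKMC IsOf KMC) (hCassels : bsdRHS_eq_of_isIsogenous)
    (hGZK : rank_eq_analyticRank_of_analyticRank_le_one) (hmod : hasEntireLFunction_rat)
    (hMK : mazurKenku_exists_cyclic_isogeny)
    (hK : ∀ (W W' : WeierstrassCurve ℚ) [W.IsElliptic] [W.IsGloballyMinimal] [W'.IsElliptic]
      [W'.IsGloballyMinimal] (p : ℕ) [Fact p.Prime],
      W.analyticRank ≤ 1 → ClassO6 W p → IsIsogenous W W' → Addv W' p → 0 ≤ padicValRat p W'.j →
        ¬ p ∣ W'.torsionOrder → KMC W' p ∧ (W'.analyticRank = 1 → PerrinRiouUpToUnitAt PRRatio W' p)) :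
    O6Sharp := by
  intro W _ _ p _ hr hO
  obtain ⟨W', hW', hM', hiso, hadd', hj', ht'⟩ :=
    Addv.exists_torsionFree_member hMK hO.1 hO.2.1 hO.padicValRat_j_nonneg
  haveI := hW'
  haveI := hM'
  obtain ⟨hKMC', hPR'⟩ := hK W W' p hr hO hiso hadd' hj' ht'
  exact TorsionFree.missingPPartAt_of_isIsogenous_of_kmc hR hC hreal hread hCassels hGZK hmod W W' p hiso
    hr hO.1 hadd' hj' ht' hPR' hKMC'

/-- **`O5Sharp` (tame odd additive potentially supersingular pairs, Gss2 ∪ (t′), X3 ∪ X4, `r_an ≤ 1`)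
FOLLOWS from the same inputs with KMC_p⁺ ⊕ PR^× at the `p`-torsion-free members of each O5 class** —
part 9's `o5Sharp_of_kmc_torsionFree_members` with the member binder discharged. Nothing is credited.
[cite: Kato2004Asterisque, Conj. 12.10 (p. 224)] [cite: BurnsKuriharaSano2019, Thm. 7.6 (p. 29)]
[cite: Cassels1965ArithmeticVIII] [cite: SilvermanAEC2009, IX.6 Example 6.4] -/
theorem o5Sharp_of_kmc_torsionFree (hR : TorsionFree.DescentCountReading IsOf)
    (hC : TorsionFree.RankOneCountReading IsOf PRRatio) (hreal : TorsionFree.RealizableOfKMC IsOf KMC)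
    (hread : ReadsTrivialKMC IsOf KMC) (hCassels : bsdRHS_eq_of_isIsogenous)
    (hGZK : rank_eq_analyticRank_of_analyticRank_le_one) (hmod : hasEntireLFunction_rat)
    (hMK : mazurKenku_exists_cyclic_isogeny)
    (hK : ∀ (W W' : WeierstrassCurve ℚ) [W.IsElliptic] [W.IsGloballyMinimal] [W'.IsElliptic]
      [W'.IsGloballyMinimal] (p : ℕ) [Fact p.Prime],
      W.analyticRank ≤ 1 → ClassO5 W p → IsIsogenous W W' → Addv W' p → 0 ≤ padicValRat p W'.j →
        ¬ p ∣ W'.torsionOrder → KMC W' p ∧ (W'.analyticRank = 1 → PerrinRiouUpToUnitAt PRRatio W' p)) :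
    O5Sharp := by
  intro W _ _ p _ hr hO
  obtain ⟨W', hW', hM', hiso, hadd', hj', ht'⟩ :=
    Addv.exists_torsionFree_member hMK hO.1 hO.2.1 hO.padicValRat_j_nonneg
  haveI := hW'
  haveI := hM'
  obtain ⟨hKMC', hPR'⟩ := hK W W' p hr hO hiso hadd' hj' ht'
  exact TorsionFree.missingPPartAt_of_isIsogenous_of_kmc hR hC hreal hread hCassels hGZK hmod W W' p hiso
    hr hO.1 hadd' hj' ht' hPR' hKMC'

/-- **`O6.X3WildOfKMC (KMCIntegralWithPerrinRiou KMC PRRatio) isog` with the `isog` existential made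
explicit**: on every X3-wild pair of analytic rank `≤ 1`, KMC₃⁺ ⊕ PR^× at the torsion-free members
(which EXIST, §2) gives `MissingPPartAt W 3` — part 9's `O6.x3WildOfKMC_of_torsionFree_readings`
composed with `ClassO6.exists_isogTorsionFreeAt3`. Nothing is credited.
[cite: Kato2004Asterisque, Conj. 12.10 (p. 224)] [cite: BurnsKuriharaSano2019, Thm. 7.6 (p. 29)] -/
theorem O6.X3Wild.missingPPartAt_three_of_kmc_isogTorsionFree (hR : TorsionFree.DescentCountReading IsOf)
    (hC : TorsionFree.RankOneCountReading IsOf PRRatio) (hreal : TorsionFree.RealizableOfKMC IsOf KMC)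
    (hread : ReadsTrivialKMC IsOf KMC) (hCassels : bsdRHS_eq_of_isIsogenous)
    (hGZK : rank_eq_analyticRank_of_analyticRank_le_one) (hmod : hasEntireLFunction_rat)
    (hMK : mazurKenku_exists_cyclic_isogeny)
    (W : WeierstrassCurve ℚ) [W.IsElliptic] [W.IsGloballyMinimal] (hr : W.analyticRank ≤ 1)
    (hX : ClassX3 W 3) (hW : SubW W 3)
    (hK : ∀ (W' : WeierstrassCurve ℚ) [W'.IsElliptic] [W'.IsGloballyMinimal],
      O6.IsogTorsionFreeAt3 W W' → O6.KMCIntegralWithPerrinRiou KMC PRRatio W' 3) :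
    MissingPPartAt W 3 := by
  have hO : ClassO6 W 3 := ⟨by decide, hX.2, hW⟩
  obtain ⟨W', hW', hM', hisog⟩ := ClassO6.exists_isogTorsionFreeAt3 hMK hO
  haveI := hW'
  haveI := hM'
  exact O6.x3WildOfKMC_of_torsionFree_readings hR hC hreal hread hCassels hGZK hmod W hr hX hW
    ⟨W', hW', hM', hisog, hK W' hisog⟩

end Consumers

end Summit.BirchSwinnertonDyer.Rank1Residual

end
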